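import Summits.QuantumFields.BalabanUV.T4Continuum.Support.VariationalTaxiCoarseBinders
import Summits.QuantumFields.BalabanUV.T4Continuum.Support.VariationalCovariantScalarPairClosed

/-!
# T⁴ programme, spine node NE2 (U1a), lane P2 — SUPPORT: THE SCALAR COVARIANT CANONICAL PAIR AT TAXI DATA — the four transport defects
# (`w`, `a`, `m`, `m₁`) of `VariationalCovariantScalarPairClosed.scalar_pair_closed` are ONE number, the fine plaquette defect

NE2 formalisation swarm `b2b-balaban-t4-ne2-formalise-*`, leaf 04 GEN 2 (`prover-b2b-balaban-t4-ne2-formalise-leaf-04-g2-0`); sequel of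
`VariationalTaxiTransport` ∕ `VariationalTaxiCoarse` ∕ `VariationalTaxiCoarseBinders` (journal INTENT CLAIMS.log l.9212).  The closed pair
`scalar_pair_closed` (leaf-09 gen 3, p213521) keeps as DATA, besides the global frames of P⁺: the coarse bond phases `Rc` (level `n`), the
fine ones `R′` (level `nL`), the site transports `T` (level `n` → unit lattice) and `T′` (one step), and FOUR transport defects — in-block `w`
of `(Rc, T)` (UB⁺), plaquette `a` of `Rc` (REG⁺), mismatch `m` of `(Rc, R′, T′)` (FED⁺), one-step `m₁` of `(R′, T′, Rc)` (ONE⁺).  AT TAXI DATA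
— `Rc := coarseT R′` (straight `L`-bond transport), `T′ := taxiT R′` (one-step taxi contours), `T := taxiT Rc` (level-`n` taxi contours) —
all four are functions of the FINE PLAQUETTE DEFECT `a′` of `R′` alone:

  `a = L²·a′` (`coarse_comm_le`: the coarse plaquette is an `L × L` rectangle of fine ones),  `w = (d−1)(n−1)·L²a′`,
  `m = (d−1)·L(L−1)·a′`,  `m₁ = (d−1)(L−1)(L+1)·a′`,

and **`scalar_pair_closed_taxi`** is `scalar_pair_closed` with those four binders DISCHARGED BY NAME; the remaining DATA are the unit fine
phases `R′` with `‖plaq R′ − 1‖ ≤ a′`, the P⁺ frames at both levels, and the two smallness conditions (the FED⁺ absorption now reads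
`512d²·(n·(d−1)L(L−1)a′)² ≤ ½`).  SCALE CHECK (unit-smooth class, `a′ ≍ α·(nL)⁻²`): `n·w ≍ dα`, `a·n² ≍ α`, `n·m ≍ dα/n`, `n·L·m₁ ≍ dαL/n` —
every constant k-UNIFORM, as the closed pair's docstring requires, now PROVED from the plaquette defect for this class of transports:
§3 `taxi_class_bounds` — ONE class hypothesis `(nL)²·a′ ≤ c` gives the tower END's four (`n·w, n²·m, n²·m₁ ≤ (d−1)c`, `a·n² ≤ c`).

HONEST FRAMING (T4-DAG p. 1).  COMPOSITION of tree theorems at MODEL level (U(1) charged scalar; abelian taxi∕straight contours; the frames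
`G, G′, c, c′` and their defects remain DATA — a global gauge is NOT derived from the plaquette defect here); [folklore]; nothing printed is a
hypothesis ([Balaban1985BackgroundPropagators] (3.19) p.393 «U(Γ)» SHAPE only); no `def`; no `sorry`; axioms standard.  ONE level pair of the
scalar sector — NOT the tower END, NOT the vector sector, NOT NE2⁺ as printed; NE2 NOT proved; spine 0/9; rung (B)+1 finite T⁴ — NOT infinite
volume, NOT mass gap, NOT Clay.  HONEST DEPENDENCY (cell, verbatim): continuum YM on T⁴ ⇐ BetaPertH ∧ nine spine estimates (0/9 proved);
BetaPertH ⇐ (D1) ∧ (D4) ∧ CAP+tail; G-an2-4 gates asym, D1 and NE2/3/4.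
-/

noncomputable section

open scoped BigOperators ComplexConjugate
open Finset

namespace Summit.QuantumFields.BalabanUV.T4Continuum.VariationalTaxiScalarPair

open Literature.MathematicalPhysics.QuantumFieldTheory.Balaban1983to89.B5Prop11Plancherel (Tor fine unitVec)
open Literature.MathematicalPhysics.QuantumFieldTheory.Balaban1983to89.B5Prop11Lower (nsq)
open Literature.MathematicalPhysics.QuantumFieldTheory.Balaban1983to89.B5Block118 (tstep bpt bpt_add_tstep)
open Summit.QuantumFields.BalabanUV.T4Continuum.VariationalTransfer (blockSpin)
open Summit.QuantumFields.BalabanUV.T4Continuum.VariationalCovariantFederbush (piT Qc dirU mis)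
open Summit.QuantumFields.BalabanUV.T4Continuum.VariationalCovariantScalarPair (Qk Q1 Sc Sf qW)
open Summit.QuantumFields.BalabanUV.T4Continuum.VariationalCovariantUpperBound (mul_conj_of_norm_one)
open Summit.QuantumFields.BalabanUV.T4Continuum.VariationalCovariantScalarPairClosed (scalar_pair_closed)
open Summit.QuantumFields.BalabanUV.T4Continuum.VariationalTaxiTransport
open Summit.QuantumFields.BalabanUV.T4Continuum.VariationalTaxiCoarse
open Summit.QuantumFields.BalabanUV.T4Continuum.VariationalTaxiCoarseBinders

variable {d : ℕ}

/-! ## §1 The coarse plaquette is an `L × L` rectangle of fine plaquettes -/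

section CoarsePlaquette

variable (L : ℕ) [NeZero L] (N : Fin d → ℕ) [hN : ∀ μ, NeZero (N μ)]
variable {R : Tor (fine L N) → Fin d → ℂ} (hR1 : ∀ x μ, ‖R x μ‖ = 1)
include hR1

omit [NeZero L] hN in
/-- for unit phases the plaquette defect IS the commutator of the two two-bond paths: `‖plaq − 1‖ = ‖R(x,μ)R(x+e_μ,ν) − R(x,ν)R(x+e_ν,μ)‖`.
[folklore] -/
theorem norm_plaq_sub_one_eq (x : Tor (fine L N)) (μ ν : Fin d) :
    ‖plaq L N R x μ ν - 1‖ = ‖R x μ * R (x + unitVec (fine L N) μ) ν - R x ν * R (x + unitVec (fine L N) ν) μ‖ := by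
  have hu : ‖R x ν * R (x + unitVec (fine L N) ν) μ‖ = 1 := by rw [norm_mul, hR1, hR1, mul_one]
  have h1 := (mul_conj_of_norm_one (hR1 (x + unitVec (fine L N) ν) μ)).2
  have h2 := (mul_conj_of_norm_one (hR1 x ν)).2
  have e : (plaq L N R x μ ν - 1) * (R x ν * R (x + unitVec (fine L N) ν) μ)
      = R x μ * R (x + unitVec (fine L N) μ) ν - R x ν * R (x + unitVec (fine L N) ν) μ := by
    unfold plaq
    linear_combination (R x μ * R (x + unitVec (fine L N) μ) ν * conj (R x ν) * R x ν) * h1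
      + (R x μ * R (x + unitVec (fine L N) μ) ν) * h2
  rw [← e, norm_mul, hu, mul_one]

omit hN in
/-- **THE COARSE PLAQUETTE DEFECT**: the straight coarse transports commute up to `L²·a` —
`‖coarseT R y μ·coarseT R (y+e_μ) ν − coarseT R y ν·coarseT R (y+e_ν) μ‖ ≤ L·L·a` (the `L × L` rectangle `rect R (L·y) μ L ν L`). [folklore] -/
theorem coarse_comm_le {a : ℝ} (ha : ∀ x κ ι, ‖plaq L N R x κ ι - 1‖ ≤ a) (y : Tor N) (μ ν : Fin d) :
    ‖coarseT L N R y μ * coarseT L N R (y + unitVec N μ) ν - coarseT L N R y ν * coarseT L N R (y + unitVec N ν) μ‖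
      ≤ (L : ℝ) * L * a := by
  have hX : ‖piT L N R (bpt L N y 0) ν L * piT L N R (bpt L N y 0 + tstep (fine L N) ν L) μ L‖ = 1 := by
    rw [norm_mul, norm_piT L N hR1, norm_piT L N hR1, mul_one]
  unfold coarseT
  rw [← bpt_add_tstep, ← bpt_add_tstep, piT_mul_piT_shift L N hR1 (bpt L N y 0) μ ν L L, ← sub_one_mul, norm_mul, hX, mul_one]
  exact norm_rect_sub_one_le L N hR1 _ _ _ _ _ ha

end CoarsePlaquette

/-! ## §2 The closed scalar pair at taxi data -/

section Pair

variable (n L : ℕ) [NeZero n] [NeZero L] (M : Fin d → ℕ) [hM : ∀ μ, NeZero (M μ)]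

/-- **THE SCALAR COVARIANT CANONICAL PAIR AT TAXI DATA**: `VariationalCovariantScalarPairClosed.scalar_pair_closed` with
`Rc := coarseT R′`, `T′ := taxiT R′`, `T := taxiT Rc` and its four transport defects DISCHARGED from the fine plaquette defect `a′`:
`w := (d−1)(n−1)·(L·L·a′)` (`VariationalTaxiTransport.inBlock_defect_taxiT_le` at level `n` + `coarse_comm_le`), `a := L·L·a′` (`coarse_comm_le`),
`m := (d−1)·(L(L−1)·a′)` (`norm_mis_taxiT_le`), `m₁ := (d−1)(L−1)(L+1)·a′` (`inBlock_defect_taxiT_le'` ∕ `cross_defect_taxiT_le`).  Remaining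
DATA: unit fine phases with plaquette defect `a′ ≥ 0`, the P⁺ frames at both levels with their smallness, the FED⁺ absorption. [folklore] -/
theorem scalar_pair_closed_taxi {R' : Tor (fine L (fine n M)) → Fin d → ℂ} (hR1 : ∀ x μ, ‖R' x μ‖ = 1)
    {a' : ℝ} (ha0 : 0 ≤ a') (ha' : ∀ x κ ι, ‖plaq L (fine n M) R' x κ ι - 1‖ ≤ a')
    {G : Tor (fine n M) → ℂ} {G' : Tor (fine L (fine n M)) → ℂ} {c : Tor M → ℂ} {c' : Tor (fine n M) → ℂ}
    -- P⁺ data (global frames) at both levels, for the taxi∕straight transports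
    (hG : ∀ x, ‖G x‖ = 1) (hc : ∀ z, ‖c z‖ ≤ 1) {mG mB : ℝ}
    (hframe : ∀ x μ, ‖G (x + unitVec (fine n M) μ) - G x * coarseT L (fine n M) R' x μ‖ ≤ mG)
    (hblock : ∀ z j, ‖G (bpt n M z j) - c z * taxiT n M (coarseT L (fine n M) R') (bpt n M z j)‖ ≤ mB)
    (hsmall : 16 * (d : ℝ) ^ 2 * ((n : ℝ) * mG) ^ 2 + 4 * mB ^ 2 ≤ 1 / 2)
    (hG' : ∀ x, ‖G' x‖ = 1) (hc' : ∀ y, ‖c' y‖ ≤ 1) {mG' mB' : ℝ}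
    (hframe' : ∀ x μ, ‖G' (x + unitVec (fine L (fine n M)) μ) - G' x * R' x μ‖ ≤ mG')
    (hblock' : ∀ y j, ‖G' (bpt L (fine n M) y j) - c' y * taxiT L (fine n M) R' (bpt L (fine n M) y j)‖ ≤ mB')
    (hsmall' : 16 * (d : ℝ) ^ 2 * ((L : ℝ) * mG') ^ 2 + 4 * mB' ^ 2 ≤ 1 / 2)
    -- the FED⁺ absorption, now in the plaquette defect
    (habsorb : 512 * (d : ℝ) ^ 2 * ((n : ℝ) * (((d - 1 : ℕ) : ℝ) * ((L : ℝ) * ((L - 1 : ℕ) : ℝ) * a'))) ^ 2 ≤ 1 / 2)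
    (μ : Tor M → ℂ) :
    let w : ℝ := ((d - 1 : ℕ) : ℝ) * ((n - 1 : ℕ) : ℝ) * ((L : ℝ) * L * a')
    let a : ℝ := (L : ℝ) * L * a'
    let m : ℝ := ((d - 1 : ℕ) : ℝ) * ((L : ℝ) * ((L - 1 : ℕ) : ℝ) * a')
    let m₁ : ℝ := ((d - 1 : ℕ) : ℝ) * ((L - 1 : ℕ) : ℝ) * ((L : ℝ) + 1) * a'
    let Λc : ℝ := 2 * d * (36 : ℝ) ^ d * ((1 + n * w) ^ 2 + 9)
    let CP : ℝ := 1088 * d + 128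
    let CR : ℝ := 2 * Λc + 2 * d * (a * (n : ℝ) ^ 2) + (d : ℝ) ^ 2 * (a * (n : ℝ) ^ 2) ^ 2 * CP
    let ε₁ : ℝ := ((d : ℝ) / 4 + 1 / 2) * ((L : ℝ) / (n : ℝ) ^ 2)
    let δ' : ℝ := Real.sqrt (2 * d * (1 + (d : ℝ) ^ 2)) * ((n : ℝ) * L * m₁)
    let Λ : ℝ := Λc + (ε₁ * CR + 2 * δ' * Real.sqrt ((1 + ε₁ * CR) * CP) + δ' ^ 2 * CP) * (Λc + 1)
    blockSpin (Qk n M (taxiT n M (coarseT L (fine n M) R'))) (Sc n M (coarseT L (fine n M) R')) μ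
        ≤ blockSpin (Qk n M (taxiT n M (coarseT L (fine n M) R')) ∘ Q1 n L M (taxiT L (fine n M) R')) (Sf n L M R') μ
          + (2 * (Real.sqrt d * ((n : ℝ) * m)) * Real.sqrt (Λ * (CP * (Λ + 1)))
              + (Real.sqrt d * ((n : ℝ) * m)) ^ 2 * (CP * (Λ + 1))) * nsq μ ∧
      blockSpin (Qk n M (taxiT n M (coarseT L (fine n M) R')) ∘ Q1 n L M (taxiT L (fine n M) R')) (Sf n L M R') μ
        ≤ blockSpin (Qk n M (taxiT n M (coarseT L (fine n M) R'))) (Sc n M (coarseT L (fine n M) R')) μ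
          + (ε₁ * CR * (Λ + 1) + 2 * δ' * Real.sqrt ((Λ + ε₁ * CR * (Λ + 1)) * (CP * (Λ + 1)))
              + δ' ^ 2 * (CP * (Λ + 1))) * nsq μ := by
  intro w a m m₁
  -- the straight coarse transport: unit modulus, plaquette defect `L²a′` (commutator form for REG⁺, `plaq − 1` form for the in-block lemma)
  have hRc1 : ∀ y μ, ‖coarseT L (fine n M) R' y μ‖ = 1 := norm_coarseT L (fine n M) hR1
  have hP : ∀ x μ ν, ‖coarseT L (fine n M) R' x μ * coarseT L (fine n M) R' (x + unitVec (fine n M) μ) ν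
      - coarseT L (fine n M) R' x ν * coarseT L (fine n M) R' (x + unitVec (fine n M) ν) μ‖ ≤ a :=
    coarse_comm_le L (fine n M) hR1 ha'
  have hPc : ∀ x κ ν, ‖plaq n M (coarseT L (fine n M) R') x κ ν - 1‖ ≤ a := fun x κ ν => by
    rw [norm_plaq_sub_one_eq n M hRc1]; exact hP x κ ν
  have ha : 0 ≤ a := by positivity
  -- UB⁺ data at level n: taxi contours of the coarse transport
  have hT1c : ∀ x, ‖taxiT n M (coarseT L (fine n M) R') x‖ = 1 := norm_taxiT n M hRc1
  have hw0 : 0 ≤ w := by positivity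
  have hw : ∀ (y : Tor M) (j : Fin d → Fin n) (μ : Fin d), (j μ : ℕ) + 1 < n →
      ‖coarseT L (fine n M) R' (bpt n M y j) μ * conj (taxiT n M (coarseT L (fine n M) R') (bpt n M y j + unitVec (fine n M) μ))
        * taxiT n M (coarseT L (fine n M) R') (bpt n M y j) - 1‖ ≤ w :=
    fun y j μ h => inBlock_defect_taxiT_le n M hRc1 hPc y j μ h
  -- FED⁺ / ONE⁺ data one step up: taxi contours of the fine phases
  have hT1 : ∀ x, ‖taxiT L (fine n M) R' x‖ = 1 := norm_taxiT L (fine n M) hR1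
  have hR' : ∀ x μ, ‖R' x μ‖ ≤ 1 := fun x μ => (hR1 x μ).le
  have hm : 0 ≤ m := by positivity
  have hmis : ∀ y μ j, ‖mis L (fine n M) (coarseT L (fine n M) R') R' (taxiT L (fine n M) R') y μ j‖ ≤ m :=
    fun y μ j => norm_mis_taxiT_le L (fine n M) hR1 ha' y μ j
  have hm₁ : 0 ≤ m₁ := by positivity
  have hin : ∀ (y : Tor (fine n M)) (j : Fin d → Fin L) (μ : Fin d), (j μ : ℕ) + 1 < L →
      ‖R' (bpt L (fine n M) y j) μ * conj (taxiT L (fine n M) R' (bpt L (fine n M) y j + unitVec (fine L (fine n M)) μ))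
        * taxiT L (fine n M) R' (bpt L (fine n M) y j) - 1‖ ≤ m₁ :=
    fun y j μ h => inBlock_defect_taxiT_le' L (fine n M) hR1 ha' y j μ h
  have hcross : ∀ (y : Tor (fine n M)) (j : Fin d → Fin L) (μ : Fin d), (j μ : ℕ) + 1 = L →
      ‖R' (bpt L (fine n M) y j) μ * conj (taxiT L (fine n M) R' (bpt L (fine n M) y j + unitVec (fine L (fine n M)) μ))
        * taxiT L (fine n M) R' (bpt L (fine n M) y j) - coarseT L (fine n M) R' y μ‖ ≤ m₁ :=
    fun y j μ h => cross_defect_taxiT_le L (fine n M) hR1 ha' y j μ h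
  exact scalar_pair_closed n L M hG hc hframe hblock hsmall hG' hc' hframe' hblock' hsmall' hR' hT1 hm hmis habsorb hT1c hRc1 hw0 hw
    ha hP hm₁ hin hcross μ

end Pair

/-! ## §3 The unit-smooth CLASS at taxi data: one hypothesis, the scale-invariant plaquette defect `(nL)²·a′ ≤ c` -/

section Class

/-- **THE CLASS BOUNDS AT TAXI DATA**: if the fine plaquette defect is scale-invariantly small, `(nL)²·a′ ≤ c`, then the four class
hypotheses of the tower END (`n·w`, `a·n²`, `n²·m`, `n²·m₁` bounded, road owner's `VariationalCovariantEnd`) hold with the constants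
`(d−1)c, c, (d−1)c, (d−1)c` for the taxi-data defects `w = (d−1)(n−1)·L²a′`, `a = L²a′`, `m = (d−1)·L(L−1)a′`, `m₁ = (d−1)(L−1)(L+1)a′`.
Pure real arithmetic. [folklore] -/
theorem taxi_class_bounds {d n L : ℕ} (hL : 1 ≤ L) {a' c : ℝ} (ha0 : 0 ≤ a') (hc : ((n : ℝ) * L) ^ 2 * a' ≤ c) :
    (n : ℝ) * (((d - 1 : ℕ) : ℝ) * ((n - 1 : ℕ) : ℝ) * ((L : ℝ) * L * a')) ≤ ((d - 1 : ℕ) : ℝ) * c ∧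
      (L : ℝ) * L * a' * (n : ℝ) ^ 2 ≤ c ∧
      (n : ℝ) ^ 2 * (((d - 1 : ℕ) : ℝ) * ((L : ℝ) * ((L - 1 : ℕ) : ℝ) * a')) ≤ ((d - 1 : ℕ) : ℝ) * c ∧
      (n : ℝ) ^ 2 * (((d - 1 : ℕ) : ℝ) * ((L - 1 : ℕ) : ℝ) * ((L : ℝ) + 1) * a') ≤ ((d - 1 : ℕ) : ℝ) * c := by
  have hd : 0 ≤ ((d - 1 : ℕ) : ℝ) := Nat.cast_nonneg _
  have hn : (0 : ℝ) ≤ n := Nat.cast_nonneg _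
  have hLr : (0 : ℝ) ≤ L := Nat.cast_nonneg _
  have hn1 : ((n - 1 : ℕ) : ℝ) ≤ n := by exact_mod_cast Nat.sub_le n 1
  have hn1' : 0 ≤ ((n - 1 : ℕ) : ℝ) := Nat.cast_nonneg _
  have hL1 : ((L - 1 : ℕ) : ℝ) = L - 1 := by rw [Nat.cast_sub hL, Nat.cast_one]
  have hbase : (n : ℝ) ^ 2 * ((L : ℝ) * L * a') ≤ c := by nlinarith
  have hb0 : 0 ≤ (n : ℝ) ^ 2 * ((L : ℝ) * L * a') := by positivity
  refine ⟨?_, by nlinarith, ?_, ?_⟩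
  · -- n·w = (d−1)·[(n−1)·n·L²a′] ≤ (d−1)·[n²·L²a′]
    have h1 : ((n - 1 : ℕ) : ℝ) * (n : ℝ) * ((L : ℝ) * L * a') ≤ (n : ℝ) ^ 2 * ((L : ℝ) * L * a') := by
      have : 0 ≤ (n : ℝ) * ((L : ℝ) * L * a') := by positivity
      nlinarith
    calc (n : ℝ) * (((d - 1 : ℕ) : ℝ) * ((n - 1 : ℕ) : ℝ) * ((L : ℝ) * L * a'))
        = ((d - 1 : ℕ) : ℝ) * (((n - 1 : ℕ) : ℝ) * (n : ℝ) * ((L : ℝ) * L * a')) := by ring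
      _ ≤ ((d - 1 : ℕ) : ℝ) * c := mul_le_mul_of_nonneg_left (h1.trans hbase) hd
  · -- n²·m = (d−1)·[n²·L(L−1)a′] ≤ (d−1)·[n²·L²a′]
    have h1 : (n : ℝ) ^ 2 * ((L : ℝ) * ((L - 1 : ℕ) : ℝ) * a') ≤ (n : ℝ) ^ 2 * ((L : ℝ) * L * a') := by
      rw [hL1]
      have : 0 ≤ (n : ℝ) ^ 2 * ((L : ℝ) * a') := by positivity
      nlinarith
    calc (n : ℝ) ^ 2 * (((d - 1 : ℕ) : ℝ) * ((L : ℝ) * ((L - 1 : ℕ) : ℝ) * a'))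
        = ((d - 1 : ℕ) : ℝ) * ((n : ℝ) ^ 2 * ((L : ℝ) * ((L - 1 : ℕ) : ℝ) * a')) := by ring
      _ ≤ ((d - 1 : ℕ) : ℝ) * c := mul_le_mul_of_nonneg_left (h1.trans hbase) hd
  · -- n²·m₁ = (d−1)·[n²·(L²−1)a′] ≤ (d−1)·[n²·L²a′]
    have h1 : (n : ℝ) ^ 2 * (((L - 1 : ℕ) : ℝ) * ((L : ℝ) + 1) * a') ≤ (n : ℝ) ^ 2 * ((L : ℝ) * L * a') := by
      rw [hL1]
      have : 0 ≤ (n : ℝ) ^ 2 * a' := by positivity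
      nlinarith
    calc (n : ℝ) ^ 2 * (((d - 1 : ℕ) : ℝ) * ((L - 1 : ℕ) : ℝ) * ((L : ℝ) + 1) * a')
        = ((d - 1 : ℕ) : ℝ) * ((n : ℝ) ^ 2 * (((L - 1 : ℕ) : ℝ) * ((L : ℝ) + 1) * a')) := by ring
      _ ≤ ((d - 1 : ℕ) : ℝ) * c := mul_le_mul_of_nonneg_left (h1.trans hbase) hd

end Class

end Summit.QuantumFields.BalabanUV.T4Continuum.VariationalTaxiScalarPair

end
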